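import Summits.KontsevichZagierPeriods.KontsevichZagierPeriods.Theorems.LinRedNormalFormArrangementNormalFormStubRebaseSimpleZeroNestedDiffCTools

/-!
# Stub `stub_rebaseSimpleZeroTwo`, part `rebaseSimpleZero_nestedDifferent` (crux
`ArrangementNormalForm`, line `janus-bands`) — brick `NestedDiffC`

**Type C of the rebase of a nested pair with letters of different `y`-slopes: both bounds
letter-parallel** (`RebaseDiff.good_typeC`, registered as `rebaseSimpleZero_nestedDiffC`). A
clean nest `A(y) < tᵢ < tⱼ < B(y)` with the literal `GS 0 2` integrand
`K/((y − r)(tᵢ − cᵢ(y))(tⱼ − cⱼ(y)))` (simple base pole `r`), `A ∥ cᵢ` and `B ∥ cⱼ`, on whose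
domain neither letter vanishes and the letter–letter expansion is dominated
(`|tⱼ − cⱼ| ≤ C |R|`, `R = (tⱼ − cⱼ) − (tᵢ − cᵢ)`; automatic when the two letter forms have
opposite signs, `RebaseDiff.good_typeC_of_signs`) is good for `GG 0 2 2`:
* rule (1b): `f = f · (tⱼ − cⱼ)/R + f · (−(tᵢ − cᵢ))/R` (`RebaseDiff.facCi/facCj`), both pieces
  absolutely convergent by domination;
* the piece `K/((y − r)(tᵢ − cᵢ) R)`: the reflection `tⱼ ↦ tᵢ + B(y) − tⱼ` (rule 2, an
  involution of the nest, Jacobian `−1`) turns `R` into `−(tⱼ − (B − cⱼ + cᵢ)(y))`, a letter of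
  slope `λᵢ` (as `B ∥ cⱼ`): letters of the common slope `λᵢ` on the same nest — good by the landed
  common-slope case (`RebaseDiff.good_any`);
* the piece `−K/((y − r)(tⱼ − cⱼ) R)`: the reflection `tᵢ ↦ tⱼ + A(y) − tᵢ` turns `R` into
  `tᵢ − (A + cⱼ − cᵢ)(y)`, a letter of slope `λⱼ` (as `A ∥ cᵢ`): common slope `λⱼ`, good.

References: M. Kontsevich, D. Zagier, *Periods* (2001), §1.2, rules (1b), (2).
-/

noncomputable section

open Set MeasureTheory MvPolynomial
open Literature.NumberTheory.Transcendental Literature.ModelTheory.ExponentialFields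

namespace Summit.KontsevichZagierPeriods.ArrangementNormalForm.JanusBands

namespace RebaseDiff

open SeparatePos RebasePos RebaseZero RebaseNest

variable {m m' : ℕ} {i j : Fin 2}

/-- **One reflected piece of the letter–letter expansion is good.** On the clean nest
`A(y) < tᵢ < tⱼ < B(y)` let `s₁` carry an integrand which, read through the reflection chart
`t_l ↦ t_{l'} + c(y) − t_l` of the fibre `l` through the other fibre `l'` (`c = B` if `l = j`,
`c = A` if `l = i`; the chart maps the nest onto itself), is the literal integrand with letters
`a'` of a common `y`-slope. Then `s₁` is good for `GG 0 2 2`. -/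
theorem good_reflected (s₁ : KZ.IntegralRep (0 + 1 + 2)) (hij : i ≠ j) (M : Fin m' → Cf) (A Bd : Cf)
    (L : Fin m → (Fin 0 → ℚ) × ℚ) (e : Fin m → ℕ) (p : MvPolynomial (Fin 0) ℚ) (ℓ₁ ℓ₂ : (Fin 0 → ℚ) × ℚ)
    (n₁ n₂ : ℕ) (a' : Fin 2 → Option Cf) (h1 : n₁ = 0) (hn : n₂ = 1)
    (hlam : ∃ lam : ℚ, ∀ l c, a' l = some c → c.1 (Fin.last 0) = lam)
    (hbd : Bornology.IsBounded s₁.domain) (hdom : s₁.domain = gDom 0 2 m' M (nlo i A) (nhi j Bd))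
    {l l' : Fin 2} (hll : l ≠ l') (c : Cf) (hc : (l = j ∧ l' = i ∧ c = Bd) ∨ (l = i ∧ l' = j ∧ c = A))
    (hf : ∀ w ∈ s₁.domain, glit 0 2 p L e ℓ₁ ℓ₂ n₁ n₂ a' w =
      s₁.integrand (rkMap (coefR l l' c) (xR l) c.2 w) * |((rkJac (coefR l l' c) (xR l) : ℚ) : ℝ)|) :
    Good 2 (KZ.of s₁) := by
  have mD := fun z => mem_nDom hij M A Bd z
  -- the chart maps the nest onto itself
  have hmap : ∀ (g : (Fin (0 + 1 + 2) → ℝ) → Fin (0 + 1 + 2) → ℝ),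
      (∀ w, yv (g w) = yv w) → (∀ w, tv (g w) l' = tv w l') →
      (∀ w, tv (g w) l = tv w l' + ev c (yv w) - tv w l) → ∀ w ∈ s₁.domain, g w ∈ s₁.domain := by
    intro g hy hl' hl w hw
    rw [hdom, mD] at hw ⊢
    obtain ⟨h0, h1', h2, h3⟩ := hw
    rw [hy]
    rcases hc with ⟨rfl, rfl, rfl⟩ | ⟨rfl, rfl, rfl⟩
    · rw [hl', hl]
      exact ⟨h0, h1', by linarith, by linarith⟩
    · rw [hl', hl]
      exact ⟨h0, by linarith, by linarith, h3⟩
  have hRD : ∀ w ∈ s₁.domain, rkMap (coefR l l' c) (xR l) c.2 w ∈ s₁.domain :=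
    hmap _ (yv_psiR c) (tv_psiR_other hll c) (tv_psiR_self hll c)
  have hDR : ∀ z ∈ s₁.domain, rkInv (coefR l l' c) (xR l) c.2 z ∈ s₁.domain :=
    hmap _ (yv_invR c) (tv_invR_other hll c) (tv_invR_self hll c)
  have hsa : IsSemialgebraic ℚ s₁.domain := s₁.isSemialgebraic_domain
  obtain ⟨r₁, hd, hi', hbd', hrel⟩ := rankOne_cov s₁ (coefR l l' c) (xR l) c.2 (rkJac_R_ne c) hsa hRD hDR
    (glit 0 2 p L e ℓ₁ ℓ₂ n₁ n₂ a') (isSemialgebraicFunOn_glit hsa _ _ _ _ _ _ _ _) hf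
  exact RebaseZero.good_of_sub_mem hrel (good_any r₁ M L e p ℓ₁ ℓ₂ a' (nlo i A) (nhi j Bd) h1 hn hlam
    (hbd' hbd) (hd.trans hdom) fun w _ => by rw [hi'])

/-- **Type C: both bounds letter-parallel.** A clean nest `A(y) < tᵢ < tⱼ < B(y)` with the
literal `GS 0 2` integrand (simple base pole `r = ℓ₂`, letters `cᵢ, cⱼ`), `A ∥ cᵢ` and `B ∥ cⱼ`,
such that neither letter vanishes on the domain and the letter–letter expansion is dominated
there (`|tⱼ − cⱼ(y)| ≤ C |R|`), is good for `GG 0 2 2`. [Kontsevich–Zagier 2001, §1.2, rules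
(1b), (2)] -/
theorem good_typeC (s : KZ.IntegralRep (0 + 1 + 2)) (hij : i ≠ j) (M : Fin m' → Cf) (A Bd : Cf)
    (L : Fin m → (Fin 0 → ℚ) × ℚ) (e : Fin m → ℕ) (p : MvPolynomial (Fin 0) ℚ) (ℓ₁ ℓ₂ : (Fin 0 → ℚ) × ℚ)
    (n₁ n₂ : ℕ) (a : Fin 2 → Option Cf) (ci cj : Cf) (hi : a i = some ci) (hj : a j = some cj)
    (hA : A.1 (Fin.last 0) = ci.1 (Fin.last 0)) (hB : Bd.1 (Fin.last 0) = cj.1 (Fin.last 0))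
    (h1 : n₁ = 0) (hn : n₂ = 1) (hbd : Bornology.IsBounded s.domain)
    (hdom : s.domain = gDom 0 2 m' M (nlo i A) (nhi j Bd))
    (hint : EqOn s.integrand (glit 0 2 p L e ℓ₁ ℓ₂ n₁ n₂ a) s.domain)
    (hnei : ∀ z ∈ s.domain, tv z i ≠ ev ci (yv z)) (hnej : ∀ z ∈ s.domain, tv z j ≠ ev cj (yv z)) (C : ℝ)
    (hC : ∀ z ∈ s.domain, |tv z j - ev cj (yv z)| ≤ C * |wallC i j ci cj z|) : Good 2 (KZ.of s) := by
  set T : BData := ⟨m, L, e, ℓ₁, ℓ₂, n₁, n₂⟩ with hT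
  have hglit : ∀ (q : MvPolynomial (Fin 0) ℚ) (a₀ : Fin 2 → Option Cf),
      glit 0 2 q L e ℓ₁ ℓ₂ n₁ n₂ a₀ = glitB T q a₀ := fun _ _ => rfl
  have hsa := s.isSemialgebraic_domain
  have hb := abs_facC_le i j ci cj C hC hnej
  -- rule (1b)
  obtain ⟨s₁, s₂, hd₁, hd₂, hi₁, hi₂, hrel⟩ := split_of_integrable s
    (fun z => s.integrand z * facCi i j ci cj z) (fun z => s.integrand z * facCj i j ci cj z)
    (IsSemialgebraicFunOn.mul_holds s.isSemialgebraicFunOn_integrand (isSemialgebraicFunOn_facCi i j ci cj hsa))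
    (IsSemialgebraicFunOn.mul_holds s.isSemialgebraicFunOn_integrand (isSemialgebraicFunOn_facCj i j ci cj hsa))
    (integrableOn_mul_bdd s (isSemialgebraicFunOn_facCi i j ci cj hsa) C fun z hz => (hb z hz).2.1)
    (integrableOn_mul_bdd s (isSemialgebraicFunOn_facCj i j ci cj hsa) (C + 1) fun z hz => (hb z hz).2.2)
    (fun z hz => by
      show s.integrand z = s.integrand z * facCi i j ci cj z + s.integrand z * facCj i j ci cj z
      rw [← mul_add, facCi_add_facCj i j ci cj z (hb z hz).1, mul_one])
  -- the literal integrand on the domain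
  have hlit : ∀ z ∈ s.domain, s.integrand z = Kc T p * (1 / (yv z - T.ℓ₂.2)) *
      ((1 / (tv z i - ev ci (yv z))) * (1 / (tv z j - ev cj (yv z)))) := fun z hz => by
    rw [hint hz, hglit, glitB_two T p a hij ci cj hi hj h1 hn]
  have hJ : ∀ (l l' : Fin 2) (c : Cf), |((rkJac (coefR l l' c) (xR l) : ℚ) : ℝ)| = 1 := fun l l' c => by
    rw [rkJac_R]; norm_num
  refine good_of_rel3 hrel ?_ ?_
  · -- the piece keeping the letter of `tᵢ`: reflect `tⱼ` through `tᵢ + B(y)`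
    set a' : Fin 2 → Option Cf := Function.update a j (some (Bd - cj + ci)) with ha'
    have ha'i : a' i = some ci := by rw [ha', Function.update_of_ne hij, hi]
    have ha'j : a' j = some (Bd - cj + ci) := by rw [ha', Function.update_self]
    refine good_reflected s₁ hij M A Bd L e (MvPolynomial.C (-1) * p) ℓ₁ ℓ₂ n₁ n₂ a' h1 hn
      ⟨ci.1 (Fin.last 0), fun l c hc => ?_⟩ (hd₁ ▸ hbd) (hd₁.trans hdom) hij.symm Bd (Or.inl ⟨rfl, rfl, rfl⟩)
      fun w hw => ?_
    · rcases fin_two_eq_or hij l with rfl | rfl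
      · rw [ha'i] at hc; cases hc; rfl
      · rw [ha'j] at hc; cases hc; rw [add_fst, sub_fst, hB]; ring
    · rw [hd₁] at hw
      have hzD : rkMap (coefR j i Bd) (xR j) Bd.2 w ∈ s.domain := by
        have h := (mem_nDom hij M A Bd _).1 (hdom ▸ hw)
        rw [hdom, mem_nDom hij, yv_psiR, tv_psiR_other hij.symm, tv_psiR_self hij.symm]
        obtain ⟨h0, h1', h2, h3⟩ := h
        exact ⟨h0, h1', by linarith, by linarith⟩
      have hPj := sub_ne_zero.2 (hnej _ hzD)
      have hPi := sub_ne_zero.2 (hnei _ hzD)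
      rw [hJ, mul_one, hi₁]
      show _ = s.integrand _ * facCi i j ci cj _
      rw [hlit _ hzD, facCi, wallC, hglit, glit_C_mul, glitB_two T p a' hij ci (Bd - cj + ci) ha'i ha'j h1 hn]
      rw [yv_psiR, tv_psiR_self hij.symm] at hPj
      rw [yv_psiR, tv_psiR_other hij.symm] at hPi
      rw [yv_psiR, tv_psiR_other hij.symm, tv_psiR_self hij.symm, ev_add, ev_sub]
      have key : tv w i + ev Bd (yv w) - tv w j - ev cj (yv w) - (tv w i - ev ci (yv w)) =
          -(tv w j - (ev Bd (yv w) - ev cj (yv w) + ev ci (yv w))) := by ring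
      rw [key]
      by_cases hY : yv w - (T.ℓ₂.2 : ℝ) = 0
      · simp [hY]
      by_cases hX : tv w j - (ev Bd (yv w) - ev cj (yv w) + ev ci (yv w)) = 0
      · simp [hX]
      push_cast
      field_simp
  · -- the piece keeping the letter of `tⱼ`: reflect `tᵢ` through `tⱼ + A(y)`
    set a' : Fin 2 → Option Cf := Function.update a i (some (A + cj - ci)) with ha'
    have ha'j : a' j = some cj := by rw [ha', Function.update_of_ne hij.symm, hj]
    have ha'i : a' i = some (A + cj - ci) := by rw [ha', Function.update_self]
    refine good_reflected s₂ hij M A Bd L e (MvPolynomial.C (-1) * p) ℓ₁ ℓ₂ n₁ n₂ a' h1 hn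
      ⟨cj.1 (Fin.last 0), fun l c hc => ?_⟩ (hd₂ ▸ hbd) (hd₂.trans hdom) hij A (Or.inr ⟨rfl, rfl, rfl⟩)
      fun w hw => ?_
    · rcases fin_two_eq_or hij l with rfl | rfl
      · rw [ha'i] at hc; cases hc; rw [sub_fst, add_fst, hA]; ring
      · rw [ha'j] at hc; cases hc; rfl
    · rw [hd₂] at hw
      have hzD : rkMap (coefR i j A) (xR i) A.2 w ∈ s.domain := by
        have h := (mem_nDom hij M A Bd _).1 (hdom ▸ hw)
        rw [hdom, mem_nDom hij, yv_psiR, tv_psiR_other hij, tv_psiR_self hij]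
        obtain ⟨h0, h1', h2, h3⟩ := h
        exact ⟨h0, by linarith, by linarith, h3⟩
      have hPi := sub_ne_zero.2 (hnei _ hzD)
      have hPj := sub_ne_zero.2 (hnej _ hzD)
      rw [hJ, mul_one, hi₂]
      show _ = s.integrand _ * facCj i j ci cj _
      rw [hlit _ hzD, facCj, wallC, hglit, glit_C_mul, glitB_two T p a' hij (A + cj - ci) cj ha'i ha'j h1 hn]
      rw [yv_psiR, tv_psiR_self hij] at hPi
      rw [yv_psiR, tv_psiR_other hij] at hPj
      rw [yv_psiR, tv_psiR_other hij, tv_psiR_self hij, ev_sub, ev_add]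
      have key : tv w j - ev cj (yv w) - (tv w j + ev A (yv w) - tv w i - ev ci (yv w)) =
          tv w i - (ev A (yv w) + ev cj (yv w) - ev ci (yv w)) := by ring
      rw [key]
      by_cases hY : yv w - (T.ℓ₂.2 : ℝ) = 0
      · simp [hY]
      by_cases hX : tv w i - (ev A (yv w) + ev cj (yv w) - ev ci (yv w)) = 0
      · simp [hX]
      push_cast
      field_simp

/-- **Type C with automatic domination by signs**: `tⱼ − cⱼ(y)` of constant weak sign `ε` and
`tᵢ − cᵢ(y)` of weak sign `−ε` on the domain. -/
theorem good_typeC_of_signs (s : KZ.IntegralRep (0 + 1 + 2)) (hij : i ≠ j) (M : Fin m' → Cf) (A Bd : Cf)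
    (L : Fin m → (Fin 0 → ℚ) × ℚ) (e : Fin m → ℕ) (p : MvPolynomial (Fin 0) ℚ) (ℓ₁ ℓ₂ : (Fin 0 → ℚ) × ℚ)
    (n₁ n₂ : ℕ) (a : Fin 2 → Option Cf) (ci cj : Cf) (hi : a i = some ci) (hj : a j = some cj)
    (hA : A.1 (Fin.last 0) = ci.1 (Fin.last 0)) (hB : Bd.1 (Fin.last 0) = cj.1 (Fin.last 0))
    (h1 : n₁ = 0) (hn : n₂ = 1) (hbd : Bornology.IsBounded s.domain)
    (hdom : s.domain = gDom 0 2 m' M (nlo i A) (nhi j Bd))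
    (hint : EqOn s.integrand (glit 0 2 p L e ℓ₁ ℓ₂ n₁ n₂ a) s.domain)
    (hnei : ∀ z ∈ s.domain, tv z i ≠ ev ci (yv z)) (hnej : ∀ z ∈ s.domain, tv z j ≠ ev cj (yv z))
    (ε : ℝ) (hε : ε = 1 ∨ ε = -1) (hP : ∀ z ∈ s.domain, 0 ≤ ε * (tv z j - ev cj (yv z)))
    (hQ : ∀ z ∈ s.domain, ε * (tv z i - ev ci (yv z)) ≤ 0) : Good 2 (KZ.of s) :=
  good_typeC s hij M A Bd L e p ℓ₁ ℓ₂ n₁ n₂ a ci cj hi hj hA hB h1 hn hbd hdom hint hnei hnej 1 fun z hz =>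
    dominatedC_of_signs i j ci cj ε hε z (hP z hz) (hQ z hz)

end RebaseDiff

/-- **Registered part `rebaseSimpleZero_nestedDiffC` of `rebaseSimpleZero_nestedDifferent` (stub
`stub_rebaseSimpleZeroTwo`, line `janus-bands`): type C of the rebase of a nested pair with letters
of DIFFERENT `y`-slopes — both bounds letter-parallel.** A clean nest `A(y) < tᵢ < tⱼ < B(y)`
(literal `GS 0 2` datum, simple base pole `r = ℓ₂.2`, both fibres lettered) with `A ∥ cᵢ` and
`B ∥ cⱼ`, on whose domain neither letter vanishes and the letter–letter expansion is dominated
(`|tⱼ − cⱼ(y)| ≤ C |(tⱼ − cⱼ(y)) − (tᵢ − cᵢ(y))|`; automatic when the two letter forms have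
opposite signs, `RebaseDiff.good_typeC_of_signs`), is congruent modulo `KZ.relations` to the
subgroup generated by the literal rebased class `GG 0 2 2` (`RebaseDiff.good_typeC`: rule 1b
between the two letters, each piece reflected through the other fibre (rule 2, an involution of
the nest) onto a common-slope nest). [Kontsevich–Zagier 2001, §1.2] -/
theorem rebaseSimpleZero_nestedDiffC (m m' n₁ n₂ : ℕ) (s : KZ.IntegralRep (0 + 1 + 2)) (M : Fin m' → (Fin (0 + 1) → ℚ) × ℚ) (L : Fin m → (Fin 0 → ℚ) × ℚ) (e : Fin m → ℕ) (p : MvPolynomial (Fin 0) ℚ) (ℓ₁ ℓ₂ : (Fin 0 → ℚ) × ℚ) (a : Fin 2 → Option ((Fin (0 + 1) → ℚ) × ℚ)) (i j : Fin 2) (hij : i ≠ j) (A Bd ci cj : (Fin (0 + 1) → ℚ) × ℚ) (hi : a i = some ci) (hj : a j = some cj) (hA : A.1 (Fin.last 0) = ci.1 (Fin.last 0)) (hB : Bd.1 (Fin.last 0) = cj.1 (Fin.last 0)) (h1 : n₁ = 0) (hn : n₂ = 1) (hbd : Bornology.IsBounded s.domain) (hdom : s.domain = SeparatePos.gDom 0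 2 m' M (RebaseNest.nlo i A) (RebaseNest.nhi j Bd)) (hint : EqOn s.integrand (RebasePos.glit 0 2 p L e ℓ₁ ℓ₂ n₁ n₂ a) s.domain) (hnei : ∀ z ∈ s.domain, RebaseZero.tv z i ≠ RebaseZero.ev ci (RebaseZero.yv z)) (hnej : ∀ z ∈ s.domain, RebaseZero.tv z j ≠ RebaseZero.ev cj (RebaseZero.yv z)) (C : ℝ) (hC : ∀ z ∈ s.domain, |RebaseZero.tv z j - RebaseZero.ev cj (RebaseZero.yv z)| ≤ C * |RebaseDiff.wallC i j ci cj z|) : ∃ c ∈ AddSubgroup.closure (SeparatePos.GGset 0 2 2), KZ.of s - c ∈ KZ.relations :=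
  RebaseDiff.good_typeC s hij M A Bd L e p ℓ₁ ℓ₂ n₁ n₂ a ci cj hi hj hA hB h1 hn hbd hdom hint hnei hnej C hC

end Summit.KontsevichZagierPeriods.ArrangementNormalForm.JanusBands
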